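import Literature.NumberTheory.LFunctions.WashingtonSinnottTheorem
import HarnessLib

/-!
# Approximate roots of a monic cubic over a valued field (kernel supply for the converse of
# `GNineCriterion`, route `CyclotomicUntwist`, crux K1 stmt-BirchSwinnertonDyer-21580)

HONEST FRAMING. Helper theorems only (`--supports stmt-BirchSwinnertonDyer-21580`): route-free
valuation algebra for a monic cubic `f = x³ + A x² + B x + C` with integral coefficients over a field
`K` carrying a valuation `v` (multiplicative notation, `v ≤ 1` = integral). Nothing about BSD.
This is the local engine of the planned theorem "`(G₉)` on the wild cell at `3` ⟹ `Δ_min` is a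
`3`-adic square" (the supercuspidal-unramified rows are not `(G₉)`; LEAD-CENSUS-v1 §Stubs), run on
the `2`-division cubic of the curve over `ℚ(ζ₉)`; no local class field theory, no completion.

Notation in the docstrings: `a_R = 3R + A = f″(R)/2`, `b_R = 3R² + 2AR + B = f′(R)`,
`c_R = f(R)`, `D = A²B² − 4B³ − 4A³C − 27C² + 18ABC = disc(f)`; "approximate root" = `v(f(R))`
small. What is proved (all by the ultrametric inequality and polynomial identities):
* §1 identities: `D` in terms of `(a_R, b_R, c_R)` (translation invariance), `a_R² − 3b_R = A² − 3B`
  (invariance of `c₄`), the difference identities `f(S) − f(R) = (S−R)·(b_R + (S−R)(S−R+a_R))`;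
* §2 `val_deriv_pow_three_eq`: under POTENTIAL GOOD REDUCTION `v(A² − 3B)³ ≤ v(D)` (`ord j ≥ 0`),
  an approximate root has `v(f′(R))³ = v(D)` EXACTLY and `v(a_R)² ≤ v(f′(R))` (the three roots are
  pairwise equidistant and `R` sits at that distance from two of them — proved without roots);
* §3 `dichotomy`: two approximate roots are either VERY close (`v(S−R)·s² ≤ ε`) or at distance
  EXACTLY `s` (`v(f′(R)) = s²`); `false_of_four_classes`: four pairwise `s`-separated approximate
  roots do not exist; `val_disc_sub_sq_le`: three pairwise `s`-separated approximate roots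
  `x₁, x₂, x₃` have `D ≈ ((x₁−x₂)(x₁−x₃)(x₂−x₃))²` (approximate Vieta).

References: J. H. Silverman, *AEC* III.1, VII.5.5; standard Newton/Krasner-type valuation estimates.
-/

-- D-0017 layout: summit = sub-problem ⇒ namespace `Summit.BirchSwinnertonDyer.BirchSwinnertonDyer.…`.
set_option linter.dupNamespace false

namespace Summit.BirchSwinnertonDyer.BirchSwinnertonDyer.Theorems.GNineConverse

open Literature.NumberTheory.LFunctions

variable {K : Type*} [Field K] {Γ₀ : Type*} [LinearOrderedCommGroupWithZero Γ₀] (v : Valuation K Γ₀)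

/-! ### §1 Polynomial identities -/

/-- Translation invariance of the discriminant of `x³ + A x² + B x + C`: it equals the discriminant
of the Taylor expansion at `R`, whose coefficients are `a_R = 3R + A`, `b_R = f′(R)`, `c_R = f(R)`.
[cite: SilvermanAEC2009, III.1] -/
theorem disc_eq_taylor (A B C R : K) :
    A ^ 2 * B ^ 2 - 4 * B ^ 3 - 4 * A ^ 3 * C - 27 * C ^ 2 + 18 * A * B * C =
      (3 * R ^ 2 + 2 * A * R + B) ^ 2 * ((3 * R + A) ^ 2 - 4 * (3 * R ^ 2 + 2 * A * R + B)) +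
        (R ^ 3 + A * R ^ 2 + B * R + C) *
          (-4 * (3 * R + A) ^ 3 - 27 * (R ^ 3 + A * R ^ 2 + B * R + C) +
            18 * (3 * R + A) * (3 * R ^ 2 + 2 * A * R + B)) := by
  ring

/-- Invariance of `c₄`: `a_R² − 3 b_R = A² − 3B`. [cite: SilvermanAEC2009, III.1] -/
theorem aR_sq_sub_three_bR (A B R : K) :
    (3 * R + A) ^ 2 - 3 * (3 * R ^ 2 + 2 * A * R + B) = A ^ 2 - 3 * B := by
  ring

/-- The difference identity `f(S) − f(R) = (S − R)·(b_R + (S − R)·((S − R) + a_R))`. [folklore] -/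
theorem eval_sub_eval (A B C R S : K) :
    (S ^ 3 + A * S ^ 2 + B * S + C) - (R ^ 3 + A * R ^ 2 + B * R + C) =
      (S - R) * ((3 * R ^ 2 + 2 * A * R + B) + (S - R) * ((S - R) + (3 * R + A))) := by
  ring

/-- The symmetric difference identity `f(x) − f(y) = (x − y)·Q(x,y)`,
`Q(x,y) = x² + xy + y² + A(x + y) + B`. [folklore] -/
theorem eval_sub_eval_Q (A B C x y : K) :
    (x ^ 3 + A * x ^ 2 + B * x + C) - (y ^ 3 + A * y ^ 2 + B * y + C) =
      (x - y) * (x ^ 2 + x * y + y ^ 2 + A * (x + y) + B) := by ring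

/-- `Q(x,y) − Q(x,z) = (y − z)·(x + y + z + A)`. [folklore] -/
theorem Q_sub_Q (A B x y z : K) :
    (x ^ 2 + x * y + y ^ 2 + A * (x + y) + B) - (x ^ 2 + x * z + z ^ 2 + A * (x + z) + B) =
      (y - z) * (x + y + z + A) := by ring

/-! ### Valuation bookkeeping -/

variable {v}

/-- If `v(y) < v(x + y)` then `v(x) = v(x + y)`. [folklore] -/
theorem val_eq_of_add_of_lt {x y : K} (h : v y < v (x + y)) : v x = v (x + y) := by
  have h1 : v x ≤ max (v (x + y)) (v y) := by
    have := v.map_sub (x + y) y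
    rwa [add_sub_cancel_right] at this
  have h2 : v (x + y) ≤ max (v x) (v y) := v.map_add x y
  rcases le_max_iff.mp h1 with h1 | h1
  · refine le_antisymm h1 ?_
    rcases le_max_iff.mp h2 with h2 | h2
    · exact h2
    · exact absurd h2 (not_le.mpr h)
  · exact absurd (h2.trans (max_le h1 le_rfl)) (not_le.mpr h)

/-- Integrality of `a_R` and `b_R` for integral `A, B, R`. [folklore] -/
theorem val_aR_bR_le_one {A B R : K} (hA : v A ≤ 1) (hB : v B ≤ 1) (hR : v R ≤ 1) :
    v (3 * R + A) ≤ 1 ∧ v (3 * R ^ 2 + 2 * A * R + B) ≤ 1 := by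
  have h3 := valuation_natCast_le_one v 3
  have h2 := valuation_natCast_le_one v 2
  push_cast at h3 h2
  constructor
  · refine v.map_add_le ?_ hA
    rw [Valuation.map_mul]; exact mul_le_one' h3 hR
  · refine v.map_add_le (v.map_add_le ?_ ?_) hB
    · rw [Valuation.map_mul, Valuation.map_pow]; exact mul_le_one' h3 (pow_le_one₀ zero_le hR)
    · rw [Valuation.map_mul, Valuation.map_mul]; exact mul_le_one' (mul_le_one' h2 hA) hR

/-- Integrality of `f(R)` for integral `A, B, C, R`. [folklore] -/
theorem val_eval_le_one {A B C R : K} (hA : v A ≤ 1) (hB : v B ≤ 1) (hC : v C ≤ 1) (hR : v R ≤ 1) :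
    v (R ^ 3 + A * R ^ 2 + B * R + C) ≤ 1 := by
  refine v.map_add_le (v.map_add_le (v.map_add_le ?_ ?_) ?_) hC
  · rw [Valuation.map_pow]; exact pow_le_one₀ zero_le hR
  · rw [Valuation.map_mul, Valuation.map_pow]; exact mul_le_one' hA (pow_le_one₀ zero_le hR)
  · rw [Valuation.map_mul]; exact mul_le_one' hB hR

/-! ### §2 Potential good reduction pins `v(f′(R))` at an approximate root -/

/-- **`v(f′(R))³ = v(D)` at an approximate root under potential good reduction.** Hypotheses:
`A, B, C, R` integral, `v(2) = 1` (odd residue characteristic), `v(A² − 3B)³ ≤ v(D)` (`ord j ≥ 0`),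
and `R` an approximate root to precision better than the discriminant, `v(f(R)) < v(D)`.
[cite: SilvermanAEC2009, VII.5.5] -/
theorem val_deriv_pow_three_eq {A B C R : K} (hA : v A ≤ 1) (hB : v B ≤ 1) (hC : v C ≤ 1)
    (hR : v R ≤ 1) (h2 : v (2 : K) = 1)
    (hpg : v (A ^ 2 - 3 * B) ^ 3 ≤ v (A ^ 2 * B ^ 2 - 4 * B ^ 3 - 4 * A ^ 3 * C - 27 * C ^ 2 + 18 * A * B * C))
    (hc : v (R ^ 3 + A * R ^ 2 + B * R + C) <
      v (A ^ 2 * B ^ 2 - 4 * B ^ 3 - 4 * A ^ 3 * C - 27 * C ^ 2 + 18 * A * B * C)) :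
    v (3 * R ^ 2 + 2 * A * R + B) ^ 3 =
        v (A ^ 2 * B ^ 2 - 4 * B ^ 3 - 4 * A ^ 3 * C - 27 * C ^ 2 + 18 * A * B * C) ∧
      v ((3 * R + A) ^ 2 - 4 * (3 * R ^ 2 + 2 * A * R + B)) = v (3 * R ^ 2 + 2 * A * R + B) ∧
      v (3 * R + A) ^ 2 ≤ v (3 * R ^ 2 + 2 * A * R + B) := by
  set a := 3 * R + A with ha
  set b := 3 * R ^ 2 + 2 * A * R + B with hb
  set c := R ^ 3 + A * R ^ 2 + B * R + C with hcdef
  set D := A ^ 2 * B ^ 2 - 4 * B ^ 3 - 4 * A ^ 3 * C - 27 * C ^ 2 + 18 * A * B * C with hD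
  obtain ⟨hva, hvb⟩ := val_aR_bR_le_one (v := v) hA hB hR
  have h4 : v (4 : K) = 1 := by
    rw [show (4 : K) = 2 * 2 by norm_num, Valuation.map_mul, h2, one_mul]
  -- `D = b²(a² − 4b) + c·E` with `E` integral
  have hE : v (-4 * a ^ 3 - 27 * c + 18 * a * b) ≤ 1 := by
    have h27 := valuation_natCast_le_one v 27
    have h18 := valuation_natCast_le_one v 18
    push_cast at h27 h18
    have hc1 : v c ≤ 1 := val_eval_le_one hA hB hC hR
    refine v.map_add_le (v.map_sub_le ?_ ?_) ?_
    · rw [Valuation.map_mul, Valuation.map_neg, h4, one_mul, Valuation.map_pow]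
      exact pow_le_one₀ zero_le hva
    · rw [Valuation.map_mul]; exact mul_le_one' h27 hc1
    · rw [Valuation.map_mul, Valuation.map_mul]; exact mul_le_one' (mul_le_one' h18 hva) hvb
  have hDeq : D = b ^ 2 * (a ^ 2 - 4 * b) + c * (-4 * a ^ 3 - 27 * c + 18 * a * b) := by
    rw [hD, ha, hb, hcdef]; ring
  have hmain : v (b ^ 2 * (a ^ 2 - 4 * b)) = v D := by
    have hlt : v (c * (-4 * a ^ 3 - 27 * c + 18 * a * b)) < v (b ^ 2 * (a ^ 2 - 4 * b) +
        c * (-4 * a ^ 3 - 27 * c + 18 * a * b)) := by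
      rw [← hDeq, Valuation.map_mul]
      exact lt_of_le_of_lt (mul_le_of_le_one_right' hE) hc
    rw [val_eq_of_add_of_lt hlt, ← hDeq]
  rw [Valuation.map_mul, Valuation.map_pow] at hmain
  -- `a² − 4b = (a² − 3b) − b`, `v(a² − 3b)³ ≤ v D`
  have hγ : v (a ^ 2 - 3 * b) ^ 3 ≤ v D := by rw [ha, hb, aR_sq_sub_three_bR]; exact hpg
  have hsplit : a ^ 2 - 4 * b = (a ^ 2 - 3 * b) + (-b) := by ring
  -- case analysis on `v b` vs `v (a² − 3b)`
  have key : v b ^ 3 = v D ∧ v (a ^ 2 - 4 * b) = v b := by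
    have hnegb : v (-b) = v b := v.map_neg b
    rcases lt_trichotomy (v (a ^ 2 - 3 * b)) (v b) with hlt | heq | hgt
    · -- `b` dominates: `v(a² − 4b) = v b`
      have hlt' : v (a ^ 2 - 3 * b) < v (-b) := by rwa [hnegb]
      have h1 : v (a ^ 2 - 4 * b) = v b := by
        rw [hsplit, v.map_add_eq_of_lt_right hlt', hnegb]
      rw [h1] at hmain
      exact ⟨by rw [← hmain, pow_succ], h1⟩
    · -- equal valuations: `v(a² − 4b) ≤ v b`, then squeeze
      have h1 : v (a ^ 2 - 4 * b) ≤ v b := by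
        rw [hsplit]; exact v.map_add_le heq.le (by rw [hnegb])
      have h3 : v D ≤ v b ^ 3 := by
        calc v D = v b ^ 2 * v (a ^ 2 - 4 * b) := hmain.symm
          _ ≤ v b ^ 2 * v b := mul_le_mul_right h1 _
          _ = v b ^ 3 := by rw [← pow_succ]
      have h5 : v b ^ 3 ≤ v D := by rw [← heq]; exact hγ
      have h6 : v b ^ 3 = v D := le_antisymm h5 h3
      refine ⟨h6, ?_⟩
      by_cases hb0 : v b = 0
      · rw [hb0] at h1 ⊢; exact le_antisymm h1 zero_le
      · have hmain' : v b ^ 2 * v (a ^ 2 - 4 * b) = v b ^ 2 * v b := by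
          rw [hmain, ← h6, pow_succ]
        exact mul_left_cancel₀ (pow_ne_zero 2 hb0) hmain'
    · -- `a² − 3b` dominates: contradiction with `v(a²−3b)³ ≤ v D`
      have hgt' : v (-b) < v (a ^ 2 - 3 * b) := by rwa [hnegb]
      have h1 : v (a ^ 2 - 4 * b) = v (a ^ 2 - 3 * b) := by
        rw [hsplit, v.map_add_eq_of_lt_left hgt']
      rw [h1] at hmain
      exfalso
      have hγ0 : v (a ^ 2 - 3 * b) ≠ 0 := ne_of_gt (lt_of_le_of_lt zero_le hgt)
      -- `γ³ ≤ v D = v b² · γ` ⟹ `γ² ≤ v b²` ⟹ contradiction with `v b < γ`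
      have h7 : v (a ^ 2 - 3 * b) ^ 2 * v (a ^ 2 - 3 * b) ≤ v b ^ 2 * v (a ^ 2 - 3 * b) := by
        rw [← pow_succ, hmain]; exact hγ
      have h8 : v (a ^ 2 - 3 * b) ^ 2 ≤ v b ^ 2 :=
        (mul_le_mul_iff_left₀ (zero_lt_iff.mpr hγ0)).mp h7
      have h9 : v b ^ 2 < v (a ^ 2 - 3 * b) ^ 2 := pow_lt_pow_left₀ hgt zero_le two_ne_zero
      exact absurd h8 (not_le.mpr h9)
  obtain ⟨k1, k2⟩ := key
  refine ⟨k1, k2, ?_⟩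
  -- `a² = (a² − 4b) + 4b`
  have e : a ^ 2 = (a ^ 2 - 4 * b) + 4 * b := by ring
  calc v a ^ 2 = v (a ^ 2) := (Valuation.map_pow v a 2).symm
    _ = v ((a ^ 2 - 4 * b) + 4 * b) := by rw [← e]
    _ ≤ max (v (a ^ 2 - 4 * b)) (v (4 * b)) := v.map_add _ _
    _ = v b := by rw [k2, Valuation.map_mul, h4, one_mul, max_self]

/-! ### §3 Classes of approximate roots -/

/-- **Dichotomy.** If `v(f′(R)) = s²`, `v(a_R) ≤ s` and `R, S` are approximate roots to precision
`ε < s³`, then either `v(S − R) = s` exactly or `S` is very close to `R`: `v(S − R)·s² ≤ ε`. [folklore] -/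
theorem dichotomy {A B C R S : K} {s ε : Γ₀} (hs : v (3 * R ^ 2 + 2 * A * R + B) = s ^ 2)
    (ha : v (3 * R + A) ≤ s) (hR : v (R ^ 3 + A * R ^ 2 + B * R + C) ≤ ε)
    (hS : v (S ^ 3 + A * S ^ 2 + B * S + C) ≤ ε) (hε : ε < s ^ 3) :
    v (S - R) = s ∨ v (S - R) * s ^ 2 ≤ ε := by
  have hs0 : s ≠ 0 := by
    rintro rfl; rw [zero_pow three_ne_zero] at hε; exact not_lt_of_ge zero_le hε
  have hdiff : v ((S - R) * ((3 * R ^ 2 + 2 * A * R + B) + (S - R) * ((S - R) + (3 * R + A)))) ≤ ε := by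
    rw [← eval_sub_eval]; exact v.map_sub_le hS hR
  rw [Valuation.map_mul] at hdiff
  rcases lt_trichotomy (v (S - R)) s with hlt | heq | hgt
  · right
    have h1 : v ((S - R) * ((S - R) + (3 * R + A))) < v (3 * R ^ 2 + 2 * A * R + B) := by
      rw [Valuation.map_mul, hs, pow_two]
      exact mul_lt_mul_of_lt_of_le_of_nonneg_of_pos hlt (v.map_add_le hlt.le ha) zero_le
        (zero_lt_iff.mpr hs0)
    rwa [v.map_add_eq_of_lt_left h1, hs] at hdiff
  · exact Or.inl heq
  · exfalso
    have h0 : v ((S - R) + (3 * R + A)) = v (S - R) :=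
      v.map_add_eq_of_lt_left (lt_of_le_of_lt ha hgt)
    have hss : s ^ 2 < v (S - R) * v (S - R) := by
      rw [pow_two]; exact mul_lt_mul'' hgt hgt zero_le zero_le
    have h1 : v (3 * R ^ 2 + 2 * A * R + B) < v ((S - R) * ((S - R) + (3 * R + A))) := by
      rw [Valuation.map_mul, h0, hs]; exact hss
    rw [v.map_add_eq_of_lt_right h1, Valuation.map_mul, h0] at hdiff
    have h3 : s ^ 3 < v (S - R) * (v (S - R) * v (S - R)) := by
      rw [pow_succ']
      exact mul_lt_mul'' hgt hss zero_le zero_le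
    exact absurd (lt_trans hε h3) (not_lt.mpr hdiff)

/-- If `v(x)·s ≤ ε` and `v(y)·s ≤ ε` then `v(x − y)·s ≤ ε`. [folklore] -/
theorem val_sub_mul_le {x y : K} {s ε : Γ₀} (hx : v x * s ≤ ε) (hy : v y * s ≤ ε) :
    v (x - y) * s ≤ ε := by
  rcases le_max_iff.mp (v.map_sub x y) with h | h
  · exact (mul_le_mul' h le_rfl).trans hx
  · exact (mul_le_mul' h le_rfl).trans hy

/-- If `v(x)·t ≤ ε` and `v(y)·t ≤ ε` then `v(x + y)·t ≤ ε`. [folklore] -/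
theorem val_add_mul_le {x y : K} {t ε : Γ₀} (hx : v x * t ≤ ε) (hy : v y * t ≤ ε) :
    v (x + y) * t ≤ ε := by
  rcases le_max_iff.mp (v.map_add x y) with h | h
  · exact (mul_le_mul' h le_rfl).trans hx
  · exact (mul_le_mul' h le_rfl).trans hy

/-- If `v(x) ≤ m` and `m·t ≤ ε` then `v(x·y)·t ≤ ε` for integral `y`. [folklore] -/
theorem val_mul_mul_le {x y : K} {m t ε : Γ₀} (hx : v x ≤ m) (hy : v y ≤ 1) (hm : m * t ≤ ε) :
    v (x * y) * t ≤ ε := by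
  rw [Valuation.map_mul]
  exact (mul_le_mul' (mul_le_of_le_of_le_one hx hy) le_rfl).trans hm

/-- **At most three classes**: four approximate roots (precision `ε < s³`) pairwise at distance
exactly `s` do not exist. [folklore] -/
theorem false_of_four_classes {A B C x₁ x₂ x₃ x₄ : K} {s ε : Γ₀}
    (h₁ : v (x₁ ^ 3 + A * x₁ ^ 2 + B * x₁ + C) ≤ ε) (h₂ : v (x₂ ^ 3 + A * x₂ ^ 2 + B * x₂ + C) ≤ ε)
    (h₃ : v (x₃ ^ 3 + A * x₃ ^ 2 + B * x₃ + C) ≤ ε) (h₄ : v (x₄ ^ 3 + A * x₄ ^ 2 + B * x₄ + C) ≤ ε)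
    (d₁₂ : v (x₁ - x₂) = s) (d₁₃ : v (x₁ - x₃) = s) (d₁₄ : v (x₁ - x₄) = s)
    (d₂₃ : v (x₂ - x₃) = s) (d₂₄ : v (x₂ - x₄) = s) (d₃₄ : v (x₃ - x₄) = s) (hε : ε < s ^ 3) :
    False := by
  -- `v(Q(x₁,x_j))·s ≤ ε`
  have hQ : ∀ {y : K}, v (y ^ 3 + A * y ^ 2 + B * y + C) ≤ ε → v (x₁ - y) = s →
      v (x₁ ^ 2 + x₁ * y + y ^ 2 + A * (x₁ + y) + B) * s ≤ ε := by
    intro y hy hd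
    have := v.map_sub_le h₁ hy
    rwa [eval_sub_eval_Q, Valuation.map_mul, hd, mul_comm] at this
  -- `T_j := x₁ + x₂ + x_j + A` is tiny: `(x₂ − x_j)·T_j = Q(x₁,x₂) − Q(x₁,x_j)`
  have hT : ∀ {y : K}, v (y ^ 3 + A * y ^ 2 + B * y + C) ≤ ε → v (x₁ - y) = s → v (x₂ - y) = s →
      v (x₁ + x₂ + y + A) * s * s ≤ ε := by
    intro y hy hd hd2
    have h := val_sub_mul_le (hQ h₂ d₁₂) (hQ hy hd)
    rwa [Q_sub_Q, Valuation.map_mul, hd2, mul_comm s] at h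
  have h34 : v (x₃ - x₄) * s * s ≤ ε := by
    have e : x₃ - x₄ = (x₁ + x₂ + x₃ + A) - (x₁ + x₂ + x₄ + A) := by ring
    rw [e, mul_assoc]
    exact val_sub_mul_le (by rw [← mul_assoc]; exact hT h₃ d₁₃ d₂₃)
      (by rw [← mul_assoc]; exact hT h₄ d₁₄ d₂₄)
  rw [d₃₄, ← pow_two, ← pow_succ] at h34
  exact absurd hε (not_lt.mpr h34)

/-- **Approximate Vieta for the discriminant.** Three integral approximate roots `x₁, x₂, x₃`
(precision `ε`) pairwise at distance exactly `s` have
`v(D − ((x₁−x₂)(x₁−x₃)(x₂−x₃))²)·s² ≤ ε` (`2` a unit). [cite: SilvermanAEC2009, III.1] -/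
theorem val_disc_sub_sq_mul_le {A B C x₁ x₂ x₃ : K} {s ε : Γ₀} (hA : v A ≤ 1) (hB : v B ≤ 1)
    (hC : v C ≤ 1) (hx₁ : v x₁ ≤ 1) (hx₂ : v x₂ ≤ 1) (hx₃ : v x₃ ≤ 1) (h2 : v (2 : K) = 1)
    (hs1 : s ≤ 1)
    (h₁ : v (x₁ ^ 3 + A * x₁ ^ 2 + B * x₁ + C) ≤ ε) (h₂ : v (x₂ ^ 3 + A * x₂ ^ 2 + B * x₂ + C) ≤ ε)
    (h₃ : v (x₃ ^ 3 + A * x₃ ^ 2 + B * x₃ + C) ≤ ε)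
    (d₁₂ : v (x₁ - x₂) = s) (d₁₃ : v (x₁ - x₃) = s) (d₂₃ : v (x₂ - x₃) = s) :
    v ((A ^ 2 * B ^ 2 - 4 * B ^ 3 - 4 * A ^ 3 * C - 27 * C ^ 2 + 18 * A * B * C) -
        ((x₁ - x₂) * (x₁ - x₃) * (x₂ - x₃)) ^ 2) * s ^ 2 ≤ ε := by
  -- the quadratic `q = f − ∏(x − xᵢ)`: coefficients `q₂ = A + σ₁`, `q₁ = B − σ₂`
  set q₂ := A + (x₁ + x₂ + x₃) with hq₂
  set q₁ := B - (x₁ * x₂ + x₁ * x₃ + x₂ * x₃) with hq₁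
  set f₁ := x₁ ^ 3 + A * x₁ ^ 2 + B * x₁ + C with hf₁
  set f₂ := x₂ ^ 3 + A * x₂ ^ 2 + B * x₂ + C with hf₂
  set f₃ := x₃ ^ 3 + A * x₃ ^ 2 + B * x₃ + C with hf₃
  set V := (x₁ - x₂) * (x₁ - x₃) * (x₂ - x₃) with hV
  have hvV : v V = s ^ 3 := by
    rw [hV, Valuation.map_mul, Valuation.map_mul, d₁₂, d₁₃, d₂₃]; rw [pow_succ, pow_two]
  have hs0 : ∀ {x : K}, v x * s ^ 3 ≤ ε * s → v x * s ^ 2 ≤ ε := fun {x} h ↦ by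
    by_cases hs : s = 0
    · rw [hs, zero_pow two_ne_zero, mul_zero]; exact zero_le
    · rw [pow_succ, ← mul_assoc] at h; exact (mul_le_mul_iff_left₀ (zero_lt_iff.mpr hs)).mp h
  -- Lagrange: `q₂·V` and `q₁·V` are combinations of the `f(xᵢ)`
  have eq₂ : q₂ * V = f₁ * (x₂ - x₃) - f₂ * (x₁ - x₃) + f₃ * (x₁ - x₂) := by
    rw [hq₂, hV, hf₁, hf₂, hf₃]; ring
  have eq₁ : q₁ * V = -(f₁ * ((x₂ - x₃) * (x₂ + x₃))) + f₂ * ((x₁ - x₃) * (x₁ + x₃)) -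
      f₃ * ((x₁ - x₂) * (x₁ + x₂)) := by
    rw [hq₁, hV, hf₁, hf₂, hf₃]; ring
  have hle : ∀ {f c : K}, v f ≤ ε → v c ≤ s → v (f * c) ≤ ε * s := fun hf hc ↦ by
    rw [Valuation.map_mul]; exact mul_le_mul' hf hc
  have hsum : ∀ {a b : K}, v a ≤ 1 → v b ≤ 1 → v (a + b) ≤ 1 := fun ha hb ↦ v.map_add_le ha hb
  have hvq₂ : v q₂ * s ^ 2 ≤ ε := by
    refine hs0 ?_
    rw [← hvV, ← Valuation.map_mul, eq₂]
    refine v.map_add_le (v.map_sub_le (hle h₁ d₂₃.le) (hle h₂ d₁₃.le)) (hle h₃ d₁₂.le)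
  have hvq₁ : v q₁ * s ^ 2 ≤ ε := by
    refine hs0 ?_
    rw [← hvV, ← Valuation.map_mul, eq₁]
    refine v.map_sub_le (v.map_add_le ?_ (hle h₂ ?_)) (hle h₃ ?_)
    · rw [Valuation.map_neg]; exact hle h₁ (by
        rw [Valuation.map_mul, d₂₃]; exact mul_le_of_le_one_right' (hsum hx₂ hx₃))
    · rw [Valuation.map_mul, d₁₃]; exact mul_le_of_le_one_right' (hsum hx₁ hx₃)
    · rw [Valuation.map_mul, d₁₂]; exact mul_le_of_le_one_right' (hsum hx₁ hx₂)
  -- Taylor form at `x₁`: `D = b²(a² − 4b) + c·E`, and `b = b₀ + β`, `a = a₀ + q₂`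
  set a := 3 * x₁ + A with ha
  set b := 3 * x₁ ^ 2 + 2 * A * x₁ + B with hb
  set b₀ := (x₁ - x₂) * (x₁ - x₃) with hb₀
  set a₀ := 2 * x₁ - x₂ - x₃ with ha₀
  set β := 2 * q₂ * x₁ + q₁ with hβ
  have eb : b = b₀ + β := by rw [hb, hb₀, hβ, hq₂, hq₁]; ring
  have ea : a = a₀ + q₂ := by rw [ha, ha₀, hq₂]; ring
  have eV : V ^ 2 = b₀ ^ 2 * (a₀ ^ 2 - 4 * b₀) := by rw [hV, hb₀, ha₀]; ring
  have eD : (A ^ 2 * B ^ 2 - 4 * B ^ 3 - 4 * A ^ 3 * C - 27 * C ^ 2 + 18 * A * B * C) - V ^ 2 =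
      β * ((b + b₀) * (a ^ 2 - 4 * b)) + b₀ ^ 2 * (q₂ * (a + a₀) - 4 * β) +
        f₁ * (-4 * a ^ 3 - 27 * f₁ + 18 * a * b) := by
    rw [disc_eq_taylor A B C x₁, eV, ← hf₁, ← ha, ← hb, eb, ea]; ring
  -- integrality of the cofactors
  obtain ⟨hva, hvb⟩ := val_aR_bR_le_one (v := v) hA hB hx₁
  rw [← ha] at hva; rw [← hb] at hvb
  have h4 : v (4 : K) ≤ 1 := valuation_natCast_le_one v 4 |>.trans_eq' (by norm_cast)
  have hvb₀ : v b₀ ≤ 1 := by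
    rw [hb₀, Valuation.map_mul]
    exact mul_le_one' (v.map_sub_le hx₁ hx₂) (v.map_sub_le hx₁ hx₃)
  have hva₀ : v a₀ ≤ 1 := by
    rw [ha₀]; refine v.map_sub_le (v.map_sub_le ?_ hx₂) hx₃
    rw [Valuation.map_mul, h2, one_mul]; exact hx₁
  have hvq₂' : v q₂ ≤ 1 := hsum hA (hsum (hsum hx₁ hx₂) hx₃)
  have hvβ : v β * s ^ 2 ≤ ε := by
    rw [hβ]
    refine val_add_mul_le ?_ hvq₁
    rw [show 2 * q₂ * x₁ = q₂ * (2 * x₁) by ring]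
    refine val_mul_mul_le le_rfl ?_ hvq₂
    rw [Valuation.map_mul, h2, one_mul]; exact hx₁
  have hE : v (-4 * a ^ 3 - 27 * f₁ + 18 * a * b) ≤ 1 := by
    have h27 := valuation_natCast_le_one v 27
    have h18 := valuation_natCast_le_one v 18
    push_cast at h27 h18
    refine v.map_add_le (v.map_sub_le ?_ ?_) ?_
    · rw [Valuation.map_mul, Valuation.map_neg, Valuation.map_pow]
      exact mul_le_one' h4 (pow_le_one₀ zero_le hva)
    · rw [Valuation.map_mul]; exact mul_le_one' h27 (val_eval_le_one hA hB hC hx₁)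
    · rw [Valuation.map_mul, Valuation.map_mul]; exact mul_le_one' (mul_le_one' h18 hva) hvb
  rw [eD]
  have hs2 : s ^ 2 ≤ 1 := pow_le_one₀ zero_le hs1
  refine val_add_mul_le (val_add_mul_le (val_mul_mul_le le_rfl ?_ hvβ) ?_) ?_
  · rw [Valuation.map_mul]
    refine mul_le_one' (hsum hvb hvb₀) (v.map_sub_le ?_ ?_)
    · rw [Valuation.map_pow]; exact pow_le_one₀ zero_le hva
    · rw [Valuation.map_mul]; exact mul_le_one' h4 hvb
  · rw [show b₀ ^ 2 * (q₂ * (a + a₀) - 4 * β) = (q₂ * (a + a₀) - 4 * β) * b₀ ^ 2 from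
      mul_comm _ _]
    refine val_mul_mul_le (m := max (v q₂) (v β)) ?_ ?_ ?_
    · refine v.map_sub_le (le_trans ?_ (le_max_left _ _)) (le_trans ?_ (le_max_right _ _))
      · rw [Valuation.map_mul]; exact mul_le_of_le_one_right' (hsum hva hva₀)
      · rw [Valuation.map_mul]; exact mul_le_of_le_one_left' h4
    · rw [Valuation.map_pow]; exact pow_le_one₀ zero_le hvb₀
    · rcases le_total (v q₂) (v β) with h | h
      · rw [max_eq_right h]; exact hvβ
      · rw [max_eq_left h]; exact hvq₂
  · exact val_mul_mul_le h₁ hE ((mul_le_of_le_one_right' hs2).trans le_rfl)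

end Summit.BirchSwinnertonDyer.BirchSwinnertonDyer.Theorems.GNineConverse
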